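import Summits.BirchSwinnertonDyer.BirchSwinnertonDyer.Theorems.SchneiderFreeAdditiveX3GoodMember
import Summits.BirchSwinnertonDyer.BirchSwinnertonDyer.Theorems.SchneiderFreeAdditiveX3GordTwoBranchIMCDivOfKY
import Literature.NumberTheory.EllipticCurves.ModularityVersionApProofs
import HarnessLib

/-!
# Route `SchneiderFreeAdditiveX3` (K1 door), crux `GordTwoBranchIMC` (stmt-BirchSwinnertonDyer-19177),
# layer 2: H3 at the frame from Keller–Yin Thm. 3.5.1 (typed, OPEN) ON THE CELL — the good-member
# binders of `xac_charIdeal_map_le_of_KY_OPEN` DISCHARGED by `exists_goodMember_of_heegner`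

Cell `bsd-schneider-ideate` (HOME `run/shared/lean/pub/bsd-schneider-ideate/`), seat `door-c4` gen 7
(file 4, plumbing). PARTITION: board row B6 ∩ X3 ∩ sst-twist, r = 1, (G-ord, `e = 2`) cell (2 560
pairs); types-the-object-of the KY-reading of crux r3 WITHOUT the hypothesis «GoodMember(∀)»; closes
nothing (conditional on the PREPRINT claim `thm351_imc_isTorsion_mu_zero_charIdeal_eq_OPEN`; BSD not
advanced). THEOREMS ONLY (no definition, no named fact, no `sorry`).

* `xac_charIdeal_map_le_of_KY_OPEN_of_cell` — door-c3 g7's `xac_charIdeal_map_le_of_KY_OPEN` (p472079)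
  with its nine good-member binders `W₁, φ, hdeg, hd, hN₁, hcase₁, hred₁, hlat₁, htf₁` REPLACED by: the
  cell membership of the door's curve `W` (`ClassX3 W p`, `SubGordTwo W p`, `W` globally minimal,
  `N_W = N`) and the Ogg–Saito schema `hOS` (named fact
  `WeierstrassCurve.artinConductorExponent_tate_eq_conductorExponent_of_isElliptic`, Silverman *ATAEC*
  IV.10.2/IV.11.1, for `N_{W₁} = N` only) — the good member being PRODUCED by
  `GoodMember.exists_goodMember_of_heegner` (files 1–3: `…GoodMemberNonsplit`, `…GoodMemberLine`,
  `…GoodMember`); `p ∣ N` because `p` is additive for `W`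
  (`dvd_conductorNorm_iff_not_hasGoodReductionAtPrime`). Remaining antecedents of the KY-reading at a
  frame: `hKY` (PRE), the frame clause `¬ C p ∣ L` (F-mu), `d_K ≠ −3` (F-dK), `Λ`-torsion of `X_ac^∅`
  (CTL₀ on the door), and `hOS`.

References: T. Keller, M. Yin, arXiv:2410.23241 §3.1, Thm. 3.5.1 [KellerYin2024PotOrd];
J. H. Silverman, *ATAEC* Exercise 4.40, IV.10.2, IV.11.1 [SilvermanATAEC1994];
HOME/memos/KY24b-anatomy-P2-g12.md §4 (K-W), HOME/memos/FINDING-door-c4-g7.md.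
-/

set_option linter.dupNamespace false
set_option autoImplicit false

noncomputable section

open scoped Classical

open WeierstrassCurve NumberField IsDedekindDomain Field PowerSeries
  Literature.NumberTheory.EllipticCurves
  Literature.NumberTheory.EllipticCurves.ModularForms
  Literature.NumberTheory.EllipticCurves.GreenbergSelmer
  Literature.NumberTheory.EllipticCurves.Rank1Residual
  Literature.NumberTheory.EllipticCurves.KellerYin2024
  Summit.BirchSwinnertonDyer.Rank1Residual
  Summit.BirchSwinnertonDyer.Rank1Residual.Additive
  Summit.BirchSwinnertonDyer.Rank1Residual.X11b
  Summit.BirchSwinnertonDyer.Rank1Residual.X11b.AcSelmer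
  Summit.BirchSwinnertonDyer.Rank1Residual.X11b.Halves

namespace Summit.BirchSwinnertonDyer.BirchSwinnertonDyer.Theorems.SchneiderFree

/-- **H3 at the frame ⇐ Keller–Yin Thm. 3.5.1 (typed, OPEN) on the (G-ord, `e = 2`) cell — no
good-member hypothesis.** Data: `W/ℚ` globally minimal elliptic on the cell (`ClassX3 W p`,
`SubGordTwo W p`, `p` odd) with newform `f` of level `N = N_W`; `K` imaginary quadratic of odd
discriminant `d_K ≠ −3` with the Heegner hypothesis for `N`; an anticyclotomic `κ` with topological
generator `γ`; the socket's degree-one prime `𝔭 ∋ p` and a second prime `𝔭′ ≠ 𝔭` induced by `ι′`; a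
frame `(Ω_K ≠ 0, Ω_p ≠ 0, L)` of the branch at `𝔭′` with `¬ p ∣ L` in `R₀⟦T⟧`; `X_ac^∅(W_K)`
`Λ`-torsion. Then `Ch_Λ(X_ac^∅(W_K))·R₀⟦T⟧ ⊆ (L)`, granted the OPEN preprint claim `hKY` and the
Ogg–Saito schema `hOS`. Proof: `p ∣ N` (additive prime), so `p ∤ d_K` and
`GoodMember.exists_goodMember_of_heegner` produces the good member `W₁ →_φ W` of
`xac_charIdeal_map_le_of_KY_OPEN`. CONDITIONAL on `hKY`; nothing asserted about BSD.
[cite: KellerYin2024PotOrd, §3.1 and Thm. 3.5.1 (arXiv:2410.23241 pp. 13–20) (preprint; taken as hypothesis)]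
[cite: SilvermanATAEC1994, Exercise 4.40 (PDF p. 380) with Thm. IV.10.2 and IV.11.1] -/
theorem xac_charIdeal_map_le_of_KY_OPEN_of_cell (hKY : thm351_imc_isTorsion_mu_zero_charIdeal_eq_OPEN)
    (hOS : ∀ (V : WeierstrassCurve ℚ) (ℓ : ℕ) [Fact ℓ.Prime],
      V.artinConductorExponent_tate_eq_conductorExponent_of_isElliptic ℓ)
    {p : ℕ} [hp : Fact p.Prime] (hp2 : p ≠ 2)
    {W : WeierstrassCurve ℚ} [W.IsElliptic] [W.IsGloballyMinimal]
    (hX : ClassX3 W p) (hS : SubGordTwo W p)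
    {N : ℕ} [NeZero N] (hN : W.conductorNorm ℤ = N)
    {f : CuspForm (CongruenceSubgroup.Gamma0 N) 2} (hfW : IsNewformOf W f)
    {K : Type} [Field K] [NumberField K] (hK : IsImaginaryQuadratic K)
    (hHe : SatisfiesHeegnerHypothesis N K) (hodd : Odd (NumberField.discr K))
    (hdK : NumberField.discr K ≠ -3)
    {κ : ZpExtension K p} (hκ : κ.IsAnticyclotomic) (γ : absoluteGaloisGroup K)
    [Fact (κ.IsTopGenerator γ)]
    {𝔭 : HeightOneSpectrum (𝓞 K)} (h𝔭 : ((p : ℕ) : 𝓞 K) ∈ 𝔭.asIdeal)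
    (he : 𝔭.asIdeal.ramificationIdx (𝓞 ℚ) = 1) (hf : 𝔭.asIdeal.inertiaDeg (𝓞 ℚ) = 1)
    {𝔭' : HeightOneSpectrum (𝓞 K)} (hne : 𝔭 ≠ 𝔭') {ι' : PadicAlgCl p ≃+* ℂ}
    (hι' : BranchInducesPrime p ι' 𝔭')
    {ΩK : ℂ} {Ωp : ℂ_[p]} {L : UnrSeries p} (hΩK : ΩK ≠ 0) (hΩp : Ωp ≠ 0)
    (hL : IsBDPLFunction ι' 𝔭' κ γ f ΩK Ωp L) (hμL : ¬ C (p : unrIntegers p) ∣ L)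
    (hT : Module.IsTorsion (IwasawaAlgebra p) (XAc (W.baseChange K) p κ 𝔭 ∅ γ)) :
    (XAc.charIdeal (W.baseChange K) p κ 𝔭 ∅ γ).map (PowerSeries.map (toUnr p)) ≤ Ideal.span {L} := by
  -- `p ∣ N`: `p` is additive (in particular bad) for `W`
  have hpN : p ∣ N := by
    have h : p ∣ W.conductorNorm ℤ :=
      (dvd_conductorNorm_iff_not_hasGoodReductionAtPrime W p).mpr hX.2.1
    rwa [hN] at h
  -- the good member of the isogeny class
  obtain ⟨W₁, hW₁, hW₁min, φ, m, hdeg, hd, hN₁, hcase₁, hred₁, hlat₁, htf₁⟩ :=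
    GoodMember.exists_goodMember_of_heegner hOS hp2 W hX hS hpN K hK hHe
  haveI := hW₁
  haveI := hW₁min
  exact xac_charIdeal_map_le_of_KY_OPEN hKY hp2 hfW hK hHe hodd hdK hκ γ h𝔭 he hf hne hι' hΩK hΩp
    hL hμL φ hdeg hd (hN₁.trans hN) hcase₁ hred₁ hlat₁ htf₁ hT

end Summit.BirchSwinnertonDyer.BirchSwinnertonDyer.Theorems.SchneiderFree

end
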